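import Summits.Ventures.CertifiedManyBodySolver.M3.EtaLowestWeightLicence
import Literature.MathematicalPhysics.QuantumLattice.HubbardHighestWeightCertificate
import HarnessLib

/-!
# M3: consumers of the η-lowest-weight licence — doped sector certificates with one-sided η rows

HONEST FRAMING: first certified bounds; not a superconductivity verdict; every number
certified or labelled float.

Speedrun `mbsolver`, seat sr-mbsolver-m3-4 (memo
`run/shared/lean/speedrun/mbsolver/sr-mbsolver-m3-4/ETA-LICENCE.md`; engines ruling R-264(e):
"the chain's soundness composition (Yang commutator + gap ⇒ annihilation ⇒ ideal rows sound) is a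
CLIENT-LEDGER theorem the client files by name").  This file IS that composition, in the certificate
shapes the cell's readers already instantiate (`HubbardSpinChargeCertificate`,
`HubbardHighestWeightCertificate.re_dotProduct_ge_of_sector_certificate_annihilators`):

* `groundEnergyAt_ge_of_certificate_etaLower` — ENERGY certificates AWAY FROM HALF FILLING.  On a
  finite graph `G` with a sign `ε` alternating along every edge (bipartite nearest-neighbour hopping,
  `t′ = 0`), in the `(N+2)`-particle sector, an identity
  `H − c·1 = Σ Λᵢⱼ Oᵢᴴ Oⱼ + ((Σₖ (H Xₖ − Xₖ H) + Σₗ (Yₗ (N̂ − (N+2)) + (N̂ − (N+2)) Y'ₗ)) + Σⱼ bⱼ wⱼ)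
     + Σᵢ (Rᵢ η_ε + η†_ε R'ᵢ) + Σₖ aₖ vₖ`
  (`Λ ⪰ 0`; `wⱼ` words of non-zero particle or spin charge; `vₖ` leftover words) proves
  `c − Σₖ ‖aₖ‖ ≤ E₀(N+2)` PROVIDED two certified numbers `u ≥ E₀(N+2)`, `l ≤ E₀(N)` satisfy
  `u < l + U` — the licence under which every `(N+2)`-particle ground vector is annihilated by `η_ε`
  (`etaLower_mulVec_eq_zero_of_certified'`).  Only the ONE-SIDED rows `Rᵢ η + η† R'ᵢ` are admitted
  (`η† ψ ≠ 0` away from half filling): the "'R' rows for η only" clause of R-264(e)(1)(d).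
* `re_dotProduct_ge_of_certificate_etaLower` — the same rows in ENERGY-CONSTRAINED CORRELATOR
  certificates (`X − c·1 − κ (uE·1 − H) = …`, Wang et al. 2024 §3): for every unit `(N+2)`-particle
  ground vector `ψ` with an `S^z` eigenvalue, `c − Σₖ ‖aₖ‖ + κ (uE − E₀(N+2)) ≤ Re ⟨ψ, X ψ⟩`.
* `torus_groundEnergyAt_ge_of_certificate_etaLower`, `torus_re_dotProduct_ge_of_certificate_etaLower`
  — the even torus `(ℤ/Lℤ)^d` with Yang's `torusStagger` (the `4×4`, `U = 8`, `N + 2 = 14`, `t′ = 0`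
  rows of M3: `u = −815606355579/2^36`, `l` = the Langer–Mattis `N = 12` certificate, `u − l < 8`).

Everything is PROVED (no `sorry`, no new definitions); the proofs are compositions of the tree
theorems named above.  Han 2020 §2 (null constraints); Yang 1989 eqs. (4)–(6).
-/

namespace Summit.Ventures.CertifiedManyBodySolver.M3

open Matrix Finset
open Literature.MathematicalPhysics.QuantumLattice
open Literature.MathematicalPhysics.QuantumManyBody.StateRelaxation
open scoped BigOperators Matrix ComplexOrder

variable {Λ : Type*} [LinearOrder Λ] [Fintype Λ] (G : SimpleGraph Λ) [DecidableRel G.Adj]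

/-- **η-licensed CORRELATOR certificate (identity level, any bipartite-signed graph).**  For a unit
`(N+2)`-particle ground vector `ψ` with an `S^z` eigenvalue, certified `E₀(N+2) ≤ u`, `l ≤ E₀(N)`,
`u < l + U`, and an identity
`X − c·1 − κ (uE·1 − H) = Σ Λᵢⱼ Oᵢᴴ Oⱼ + ((Σ commutators + Σ number-ideal rows at N+2) + Σ charged words)
  + Σᵢ (Rᵢ η_ε + η†_ε R'ᵢ) + (Σₘ dₘ (Vₘᴴ − Vₘ) + Σₖ aₖ vₖ)`:
`c − Σₖ ‖aₖ‖ + κ (uE − E₀(N+2)) ≤ Re ⟨ψ, X ψ⟩`. -/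
theorem re_dotProduct_ge_of_certificate_etaLower (ε : Λ → ℤˣ)
    (hε : ∀ x y, G.Adj x y → ε x = -ε y) (t U : ℝ) {N : ℕ} {u l : ℝ}
    (hu : groundEnergyAt G t U (N + 2) ≤ u) (hl : l ≤ groundEnergyAt G t U N) (hul : u < l + U)
    {ψ : Fock (Orb Λ)} (hψN : IsNParticle (N + 2) ψ) (hψ1 : star ψ ⬝ᵥ ψ = 1)
    (hHψ : hamiltonian G t U *ᵥ ψ = ((groundEnergyAt G t U (N + 2) : ℝ) : ℂ) • ψ)
    {q : ℝ} (hSψ : HubbardWave0.spinZ *ᵥ ψ = (q : ℂ) • ψ)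
    {ζ : Type*} (sz : Finset ζ) (R R' : ζ → Matrix (Finset (Orb Λ)) (Finset (Orb Λ)) ℂ)
    (X : Matrix (Finset (Orb Λ)) (Finset (Orb Λ)) ℂ) (κ uE : ℝ)
    {m : Type*} [Fintype m] [DecidableEq m] {Λm : Matrix m m ℂ} (hΛ : Λm.PosSemidef)
    (O : m → Matrix (Finset (Orb Λ)) (Finset (Orb Λ)) ℂ)
    {κ₁ : Type*} (s : Finset κ₁) (Xc : κ₁ → Matrix (Finset (Orb Λ)) (Finset (Orb Λ)) ℂ)
    {κ₂ : Type*} (s' : Finset κ₂) (Y Y' : κ₂ → Matrix (Finset (Orb Λ)) (Finset (Orb Λ)) ℂ)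
    {ρ : Type*} (uc : Finset ρ) (b : ρ → ℂ) (cw : ρ → List (Orb Λ × Bool))
    (hcw : ∀ j ∈ uc, ladderCharge (cw j) ≠ 0 ∨ ladderSpinCharge (cw j) ≠ 0)
    {δ : Type*} (ah : Finset δ) (dc : δ → ℝ) (V : δ → Matrix (Finset (Orb Λ)) (Finset (Orb Λ)) ℂ)
    {κ₃ : Type*} (w : Finset κ₃) (a : κ₃ → ℂ) (word : κ₃ → List (Orb Λ × Bool)) {c : ℝ}
    (hcert : X - (c : ℂ) • (1 : Matrix (Finset (Orb Λ)) (Finset (Orb Λ)) ℂ) -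
        ((κ : ℝ) : ℂ) • (((uE : ℝ) : ℂ) • (1 : Matrix (Finset (Orb Λ)) (Finset (Orb Λ)) ℂ) -
          hamiltonian G t U) =
      gramForm Λm O +
        ((∑ k ∈ s, (hamiltonian G t U * Xc k - Xc k * hamiltonian G t U) +
          ∑ l ∈ s', (Y l * (totalNumberOp - ((N + 2 : ℕ) : ℂ) • 1) +
            (totalNumberOp - ((N + 2 : ℕ) : ℂ) • 1) * Y' l)) +
          ∑ j ∈ uc, b j • ladderWord (cw j)) +
        ∑ i ∈ sz, (R i * etaLower ε + etaRaise ε * R' i) +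
        (∑ m' ∈ ah, ((dc m' : ℝ) : ℂ) • ((V m')ᴴ - V m') + ∑ k ∈ w, a k • ladderWord (word k))) :
    c - ∑ k ∈ w, ‖a k‖ + κ * (uE - groundEnergyAt G t U (N + 2)) ≤ (star ψ ⬝ᵥ X *ᵥ ψ).re := by
  have hη : etaLower ε *ᵥ ψ = 0 :=
    etaLower_mulVec_eq_zero_of_certified' G ε hε t U hu hl hul hψN hHψ
  have hLH : (etaLower ε)ᴴ = etaRaise ε := conjTranspose_conjTranspose _
  exact re_dotProduct_ge_of_sector_certificate_annihilators G t U hψN hψ1 hHψ hSψ sz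
    (fun _ => etaLower ε) (fun _ _ => hη) R R' X κ uE hΛ O s Xc s' Y Y' uc b cw hcw ah dc V w a
    word (c := c) (by simpa only [hLH] using hcert)

/-- **η-licensed ENERGY certificate away from half filling (any bipartite-signed graph).**
Certified `E₀(N+2) ≤ u`, `l ≤ E₀(N)`, `u < l + U` and an identity
`H − c·1 = Σ Λᵢⱼ Oᵢᴴ Oⱼ + ((Σₖ (H Xₖ − Xₖ H) + Σₗ (Yₗ (N̂ − (N+2)) + (N̂ − (N+2)) Y'ₗ)) + Σⱼ bⱼ wⱼ)
  + Σᵢ (Rᵢ η_ε + η†_ε R'ᵢ) + Σₖ aₖ vₖ` prove `c − Σₖ ‖aₖ‖ ≤ E₀(N+2) = groundEnergyAt G t U (N+2)`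
(evaluate in a joint `(N̂, S^z)` ground vector, `exists_unit_joint_groundState`, which `η_ε`
annihilates by the licence). -/
theorem groundEnergyAt_ge_of_certificate_etaLower (ε : Λ → ℤˣ)
    (hε : ∀ x y, G.Adj x y → ε x = -ε y) (t U : ℝ) {N : ℕ} (hN : N + 2 ≤ 2 * Fintype.card Λ)
    {u l : ℝ} (hu : groundEnergyAt G t U (N + 2) ≤ u) (hl : l ≤ groundEnergyAt G t U N)
    (hul : u < l + U)
    {ζ : Type*} (sz : Finset ζ) (R R' : ζ → Matrix (Finset (Orb Λ)) (Finset (Orb Λ)) ℂ)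
    {m : Type*} [Fintype m] [DecidableEq m] {Λm : Matrix m m ℂ} (hΛ : Λm.PosSemidef)
    (O : m → Matrix (Finset (Orb Λ)) (Finset (Orb Λ)) ℂ)
    {κ₁ : Type*} (s : Finset κ₁) (Xc : κ₁ → Matrix (Finset (Orb Λ)) (Finset (Orb Λ)) ℂ)
    {κ₂ : Type*} (s' : Finset κ₂) (Y Y' : κ₂ → Matrix (Finset (Orb Λ)) (Finset (Orb Λ)) ℂ)
    {ρ : Type*} (uc : Finset ρ) (b : ρ → ℂ) (cw : ρ → List (Orb Λ × Bool))
    (hcw : ∀ j ∈ uc, ladderCharge (cw j) ≠ 0 ∨ ladderSpinCharge (cw j) ≠ 0)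
    {κ₃ : Type*} (w : Finset κ₃) (a : κ₃ → ℂ) (word : κ₃ → List (Orb Λ × Bool)) {c : ℝ}
    (hcert : hamiltonian G t U - (c : ℂ) • (1 : Matrix (Finset (Orb Λ)) (Finset (Orb Λ)) ℂ) =
      gramForm Λm O +
        ((∑ k ∈ s, (hamiltonian G t U * Xc k - Xc k * hamiltonian G t U) +
          ∑ l ∈ s', (Y l * (totalNumberOp - ((N + 2 : ℕ) : ℂ) • 1) +
            (totalNumberOp - ((N + 2 : ℕ) : ℂ) • 1) * Y' l)) +
          ∑ j ∈ uc, b j • ladderWord (cw j)) +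
        ∑ i ∈ sz, (R i * etaLower ε + etaRaise ε * R' i) +
        ∑ k ∈ w, a k • ladderWord (word k)) :
    c - ∑ k ∈ w, ‖a k‖ ≤ groundEnergyAt G t U (N + 2) := by
  obtain ⟨ψ, hψN, hψ1, hHψ, q, hSψ⟩ := exists_unit_joint_groundState G t U hN
  set H := hamiltonian G t U with hH
  set E₀ := groundEnergyAt G t U (N + 2) with hE₀
  -- the energy identity is the correlator identity with `X = H`, `κ = 0`, no anti-Hermitian rows
  have hcert' : H - (c : ℂ) • (1 : Matrix (Finset (Orb Λ)) (Finset (Orb Λ)) ℂ) -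
        (((0 : ℝ) : ℝ) : ℂ) • ((((E₀ : ℝ) : ℝ) : ℂ) • (1 : Matrix (Finset (Orb Λ)) (Finset (Orb Λ)) ℂ) - H) =
      gramForm Λm O +
        ((∑ k ∈ s, (H * Xc k - Xc k * H) +
          ∑ l ∈ s', (Y l * (totalNumberOp - ((N + 2 : ℕ) : ℂ) • 1) +
            (totalNumberOp - ((N + 2 : ℕ) : ℂ) • 1) * Y' l)) +
          ∑ j ∈ uc, b j • ladderWord (cw j)) +
        ∑ i ∈ sz, (R i * etaLower ε + etaRaise ε * R' i) +
        (∑ m' ∈ (∅ : Finset Unit), (((fun _ => (0 : ℝ)) m' : ℝ) : ℂ) •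
            (((fun _ => (0 : Matrix (Finset (Orb Λ)) (Finset (Orb Λ)) ℂ)) m')ᴴ -
              (fun _ => (0 : Matrix (Finset (Orb Λ)) (Finset (Orb Λ)) ℂ)) m') +
          ∑ k ∈ w, a k • ladderWord (word k)) := by
    rw [Finset.sum_empty, zero_add, Complex.ofReal_zero, zero_smul, sub_zero, hcert]
  have h := re_dotProduct_ge_of_certificate_etaLower G ε hε t U hu hl hul hψN hψ1 hHψ hSψ sz R R'
    H 0 E₀ hΛ O s Xc s' Y Y' uc b cw hcw ∅ (fun _ => (0 : ℝ)) (fun _ => 0) w a word (c := c) hcert'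
  have hE : (star ψ ⬝ᵥ H *ᵥ ψ).re = E₀ := by
    rw [hHψ, dotProduct_smul, hψ1, smul_eq_mul, mul_one, Complex.ofReal_re]
  rw [hE, zero_mul, add_zero] at h
  exact h

/-! ### The even torus `(ℤ/Lℤ)^d` with Yang's staggering (the M3 `4×4`, `t′ = 0` rows) -/

set_option maxHeartbeats 800000 in
/-- **Even torus, η-licensed ENERGY certificate** (`fermionTorusGraph d L`, `L` even, Yang's
`torusStagger`; the `4×4`, `U = 8`, `N + 2 = 14` rows of M3). -/
theorem torus_groundEnergyAt_ge_of_certificate_etaLower {d L : ℕ} [NeZero L] (hL : Even L)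
    (t U : ℝ) {N : ℕ} (hN : N + 2 ≤ 2 * Fintype.card (FermionTorus d L)) {u l : ℝ}
    (hu : groundEnergyAt (fermionTorusGraph d L) t U (N + 2) ≤ u)
    (hl : l ≤ groundEnergyAt (fermionTorusGraph d L) t U N) (hul : u < l + U)
    {ζ : Type*} (sz : Finset ζ)
    (R R' : ζ → Matrix (Finset (Orb (FermionTorus d L))) (Finset (Orb (FermionTorus d L))) ℂ)
    {m : Type*} [Fintype m] [DecidableEq m] {Λm : Matrix m m ℂ} (hΛ : Λm.PosSemidef)
    (O : m → Matrix (Finset (Orb (FermionTorus d L))) (Finset (Orb (FermionTorus d L))) ℂ)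
    {κ₁ : Type*} (s : Finset κ₁)
    (Xc : κ₁ → Matrix (Finset (Orb (FermionTorus d L))) (Finset (Orb (FermionTorus d L))) ℂ)
    {κ₂ : Type*} (s' : Finset κ₂)
    (Y Y' : κ₂ → Matrix (Finset (Orb (FermionTorus d L))) (Finset (Orb (FermionTorus d L))) ℂ)
    {ρ : Type*} (uc : Finset ρ) (b : ρ → ℂ) (cw : ρ → List (Orb (FermionTorus d L) × Bool))
    (hcw : ∀ j ∈ uc, ladderCharge (cw j) ≠ 0 ∨ ladderSpinCharge (cw j) ≠ 0)
    {κ₃ : Type*} (w : Finset κ₃) (a : κ₃ → ℂ) (word : κ₃ → List (Orb (FermionTorus d L) × Bool))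
    {c : ℝ}
    (hcert : hamiltonian (fermionTorusGraph d L) t U -
        (c : ℂ) • (1 : Matrix (Finset (Orb (FermionTorus d L))) (Finset (Orb (FermionTorus d L))) ℂ) =
      gramForm Λm O +
        ((∑ k ∈ s, (hamiltonian (fermionTorusGraph d L) t U * Xc k -
            Xc k * hamiltonian (fermionTorusGraph d L) t U) +
          ∑ l ∈ s', (Y l * (totalNumberOp - ((N + 2 : ℕ) : ℂ) • 1) +
            (totalNumberOp - ((N + 2 : ℕ) : ℂ) • 1) * Y' l)) +
          ∑ j ∈ uc, b j • ladderWord (cw j)) +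
        ∑ i ∈ sz, (R i * etaLower (torusStagger (d := d) (L := L)) +
          etaRaise (torusStagger (d := d) (L := L)) * R' i) +
        ∑ k ∈ w, a k • ladderWord (word k)) :
    c - ∑ k ∈ w, ‖a k‖ ≤ groundEnergyAt (fermionTorusGraph d L) t U (N + 2) := by
  have hε : ∀ x y, (fermionTorusGraph d L).Adj x y →
      torusStagger (d := d) (L := L) x = -torusStagger (d := d) (L := L) y :=
    fun _ _ h => torusStagger_eq_neg_of_adj_holds hL h
  have h := groundEnergyAt_ge_of_certificate_etaLower (fermionTorusGraph d L) torusStagger hε t U hN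
    hu hl hul sz R R' hΛ O s Xc s' Y Y' uc b cw hcw w a word (c := c) (by convert hcert)
  convert h

set_option maxHeartbeats 800000 in
/-- **Even torus, η-licensed CORRELATOR certificate**: for every unit `(N+2)`-particle ground vector
`ψ` of `fermionTorusGraph d L` (`L` even) carrying an `S^z` eigenvalue, certified `E₀(N+2) ≤ u`,
`l ≤ E₀(N)`, `u < l + U` and the identity of `re_dotProduct_ge_of_certificate_etaLower` with
`ε = torusStagger` give `c − Σₖ ‖aₖ‖ + κ (uE − E₀(N+2)) ≤ Re ⟨ψ, X ψ⟩`. -/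
theorem torus_re_dotProduct_ge_of_certificate_etaLower {d L : ℕ} [NeZero L] (hL : Even L)
    (t U : ℝ) {N : ℕ} {u l : ℝ}
    (hu : groundEnergyAt (fermionTorusGraph d L) t U (N + 2) ≤ u)
    (hl : l ≤ groundEnergyAt (fermionTorusGraph d L) t U N) (hul : u < l + U)
    {ψ : Fock (Orb (FermionTorus d L))} (hψN : IsNParticle (N + 2) ψ) (hψ1 : star ψ ⬝ᵥ ψ = 1)
    (hHψ : hamiltonian (fermionTorusGraph d L) t U *ᵥ ψ =
      ((groundEnergyAt (fermionTorusGraph d L) t U (N + 2) : ℝ) : ℂ) • ψ)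
    {q : ℝ} (hSψ : HubbardWave0.spinZ *ᵥ ψ = (q : ℂ) • ψ)
    {ζ : Type*} (sz : Finset ζ)
    (R R' : ζ → Matrix (Finset (Orb (FermionTorus d L))) (Finset (Orb (FermionTorus d L))) ℂ)
    (X : Matrix (Finset (Orb (FermionTorus d L))) (Finset (Orb (FermionTorus d L))) ℂ) (κ uE : ℝ)
    {m : Type*} [Fintype m] [DecidableEq m] {Λm : Matrix m m ℂ} (hΛ : Λm.PosSemidef)
    (O : m → Matrix (Finset (Orb (FermionTorus d L))) (Finset (Orb (FermionTorus d L))) ℂ)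
    {κ₁ : Type*} (s : Finset κ₁)
    (Xc : κ₁ → Matrix (Finset (Orb (FermionTorus d L))) (Finset (Orb (FermionTorus d L))) ℂ)
    {κ₂ : Type*} (s' : Finset κ₂)
    (Y Y' : κ₂ → Matrix (Finset (Orb (FermionTorus d L))) (Finset (Orb (FermionTorus d L))) ℂ)
    {ρ : Type*} (uc : Finset ρ) (b : ρ → ℂ) (cw : ρ → List (Orb (FermionTorus d L) × Bool))
    (hcw : ∀ j ∈ uc, ladderCharge (cw j) ≠ 0 ∨ ladderSpinCharge (cw j) ≠ 0)
    {δ : Type*} (ah : Finset δ) (dc : δ → ℝ)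
    (V : δ → Matrix (Finset (Orb (FermionTorus d L))) (Finset (Orb (FermionTorus d L))) ℂ)
    {κ₃ : Type*} (w : Finset κ₃) (a : κ₃ → ℂ) (word : κ₃ → List (Orb (FermionTorus d L) × Bool))
    {c : ℝ}
    (hcert : X - (c : ℂ) • (1 : Matrix (Finset (Orb (FermionTorus d L))) (Finset (Orb (FermionTorus d L))) ℂ) -
        ((κ : ℝ) : ℂ) • (((uE : ℝ) : ℂ) •
          (1 : Matrix (Finset (Orb (FermionTorus d L))) (Finset (Orb (FermionTorus d L))) ℂ) -
          hamiltonian (fermionTorusGraph d L) t U) =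
      gramForm Λm O +
        ((∑ k ∈ s, (hamiltonian (fermionTorusGraph d L) t U * Xc k -
            Xc k * hamiltonian (fermionTorusGraph d L) t U) +
          ∑ l ∈ s', (Y l * (totalNumberOp - ((N + 2 : ℕ) : ℂ) • 1) +
            (totalNumberOp - ((N + 2 : ℕ) : ℂ) • 1) * Y' l)) +
          ∑ j ∈ uc, b j • ladderWord (cw j)) +
        ∑ i ∈ sz, (R i * etaLower (torusStagger (d := d) (L := L)) +
          etaRaise (torusStagger (d := d) (L := L)) * R' i) +
        (∑ m' ∈ ah, ((dc m' : ℝ) : ℂ) • ((V m')ᴴ - V m') + ∑ k ∈ w, a k • ladderWord (word k))) :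
    c - ∑ k ∈ w, ‖a k‖ + κ * (uE - groundEnergyAt (fermionTorusGraph d L) t U (N + 2)) ≤
      (star ψ ⬝ᵥ X *ᵥ ψ).re := by
  have hε : ∀ x y, (fermionTorusGraph d L).Adj x y →
      torusStagger (d := d) (L := L) x = -torusStagger (d := d) (L := L) y :=
    fun _ _ h => torusStagger_eq_neg_of_adj_holds hL h
  have h := re_dotProduct_ge_of_certificate_etaLower (fermionTorusGraph d L) torusStagger hε t U hu hl
    hul hψN hψ1 hHψ hSψ sz R R' X κ uE hΛ O s Xc s' Y Y' uc b cw hcw ah dc V w a word (c := c)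
    (by convert hcert)
  convert h

end Summit.Ventures.CertifiedManyBodySolver.M3
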